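import Summits.Ventures.CertifiedManyBodySolver.Theorems.TcThermcert1FreeGasCurrentCovariance
import Summits.Ventures.CertifiedManyBodySolver.Theorems.TcThermcert1HighTempTimeReversal
import HarnessLib

/-!
# Free canonical gas at `β·t = 8` — single-site even observables: sector-diagonality and time reversal (`ω_p(A j) = 0` off the bond)

Helper file for route `TcThermcert1` (crux K1′ `ThermalStiffnessCeilingU8b8_le_7o44`, item `stmt-Ventures-24560`), crux idea
`free-canonical-b8-rung` (sketch `Cruxes/ThermalStiffnessCeilingU8b10_le_1o8/FreeCanonicalB8Sketch.lean`: targets `FreeCanonicalRungB8`,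
`FreeCanonicalRungB8Sub s`). Generic finite-dimensional algebra (any finite site set `Λ`, any real `β`, any sector-preserving real-symmetric
`H`) behind the DEGENERATE end `s ≤ 0` of the sub-extensive ladder (file `TcThermcert1FreeCanonicalRungSubZero`), where supports have
at most one site:

* §1 **single-site even observables are diagonal inside a sector**: `A ∈ CAR⁺(orbSet {x})` commutes with every number operator
  `n_{yτ}`, `y ≠ x` (graded locality, tree `commute_of_mem_carEvenSubalgebra`), so a non-zero entry `A_{st}` forces `s` and `t` to
  agree off `x`; if `s`, `t` carry the same numbers of up and of down particles they then agree at `x` too, i.e. `s = t`. Hence the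
  sector compression `P_{M,N} A P_{M,N}` is a DIAGONAL matrix.
* §2 **time reversal**: for a real-symmetric sector-preserving `H`, an observable `A` commuting with the bond current `j_{ab}` and with
  `P_{M,N}` and diagonal between distinct configurations of one sector, `tr(P_{M,N} e^{−βH} A j_{ab}) = 0` — `P e^{−βH} A j = e^{−βH}(PAP)j`
  with `(PAP) j` antisymmetric (tree `transpose_current`) and `e^{−βH}` symmetric (tree `trace_mul_eq_zero_of_transpose`); sector
  Gibbs-state form `gibbsState β H_p ((A j)_p) = 0`; and the state bound `‖gibbsState β H_p (O_p)‖ ≤ ‖O‖`.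

HONEST LABEL: finite-dimensional linear algebra serving the `U = 0` rung (BC5-type witness for the C8 bet) in its degenerate single-site
range; reach at `U = 8` ZERO; decides nothing about K1/K1′/`T_c`; superconductivity in the Hubbard model is NOT proved or advanced by this
file. No definitions; no `sorry`.
-/

noncomputable section

namespace Summit.Ventures.CertifiedManyBodySolver.Theorems.TcThermcert1.FreeCanonicalB8

open Matrix Finset
open Literature.MathematicalPhysics.QuantumLattice
open Summit.Ventures.CertifiedManyBodySolver.Theorems.TcThermcert1.FreeGasCurrentClustering
open Summit.Ventures.CertifiedManyBodySolver.Theorems.TcThermcert1.HighTempCurrentClustering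
  (trace_mul_eq_zero_of_transpose transpose_current apply_eq_of_commute_diagonal)
open scoped Matrix.Norms.L2Operator ComplexOrder

/-! ## §1 Single-site even observables are diagonal inside a sector -/

section SingleSite

variable {Λ : Type*} [LinearOrder Λ] [Fintype Λ]

/-- Two finite sets that agree off `x` and have the same cardinality agree at `x`. -/
theorem mem_iff_mem_of_card_eq {α : Type*} [DecidableEq α] {x : α} {U V : Finset α}
    (hoff : ∀ y, y ≠ x → (y ∈ U ↔ y ∈ V)) (hcard : U.card = V.card) : (x ∈ U ↔ x ∈ V) := by
  have he : U.erase x = V.erase x := by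
    ext y
    by_cases hyx : y = x
    · subst hyx; simp
    · simp only [Finset.mem_erase, ne_eq, hyx, not_false_eq_true, true_and]
      exact hoff y hyx
  by_cases hxU : x ∈ U <;> by_cases hxV : x ∈ V
  · exact iff_of_true hxU hxV
  · exfalso
    have h1 := Finset.card_erase_of_mem hxU
    have h3 := Finset.card_pos.2 ⟨x, hxU⟩
    rw [he, Finset.erase_eq_of_notMem hxV] at h1
    omega
  · exfalso
    have h1 := Finset.card_erase_of_mem hxV
    have h3 := Finset.card_pos.2 ⟨x, hxV⟩
    rw [← he, Finset.erase_eq_of_notMem hxU] at h1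
    omega
  · exact iff_of_false hxU hxV

/-- **Graded locality, entrywise.** An even observable of the single site `x` has matrix elements only between configurations that
agree at every orbital off `x` (it commutes with every number operator `n_{yτ}`, `y ≠ x`). -/
theorem mem_iff_mem_of_apply_ne_zero {x : Λ} {A : Matrix (Finset (Orb Λ)) (Finset (Orb Λ)) ℂ}
    (hA : A ∈ carEvenSubalgebra (orbSet ({x} : Finset Λ))) {s t : Finset (Orb Λ)} (hst : A s t ≠ 0)
    (k : Orb Λ) (hk : (ofLex k).1 ≠ x) : (k ∈ s ↔ k ∈ t) := by
  have hn : (creation k * annihilation k : Matrix (Finset (Orb Λ)) (Finset (Orb Λ)) ℂ) ∈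
      carSubalgebra (orbSet ({(ofLex k).1} : Finset Λ)) :=
    carEvenSubalgebra_le_carSubalgebra _ (creation_mul_annihilation_mem_carEvenSubalgebra
      (mem_orbSet.2 (Finset.mem_singleton_self _)) (mem_orbSet.2 (Finset.mem_singleton_self _)))
  have hdisj : Disjoint (orbSet ({x} : Finset Λ)) (orbSet ({(ofLex k).1} : Finset Λ)) :=
    disjoint_orbSet (Finset.disjoint_singleton_right.2 (fun h => hk (Finset.mem_singleton.1 h)))
  have hc := commute_of_mem_carEvenSubalgebra hA hn hdisj
  have hnd : (creation k * annihilation k : Matrix (Finset (Orb Λ)) (Finset (Orb Λ)) ℂ) =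
      diagonal (fun u => if k ∈ u then 1 else 0) := numberAt_eq_diagonal k
  rw [hnd] at hc
  have h : (if k ∈ s then (1 : ℂ) else 0) = (if k ∈ t then 1 else 0) := apply_eq_of_commute_diagonal hc hst
  by_cases hks : k ∈ s <;> by_cases hkt : k ∈ t
  · exact iff_of_true hks hkt
  · rw [if_pos hks, if_neg hkt] at h; exact absurd h one_ne_zero
  · rw [if_neg hks, if_pos hkt] at h; exact absurd h.symm one_ne_zero
  · exact iff_of_false hks hkt

/-- **Single-site even observables are diagonal inside a sector**: if `A ∈ CAR⁺(orbSet {x})` and `s ≠ t` carry the same numbers of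
up and of down particles, then `A s t = 0`. -/
theorem apply_eq_zero_of_mem_carEvenSubalgebra_singleton {x : Λ} {A : Matrix (Finset (Orb Λ)) (Finset (Orb Λ)) ℂ}
    (hA : A ∈ carEvenSubalgebra (orbSet ({x} : Finset Λ))) {s t : Finset (Orb Λ)} (hst : s ≠ t)
    (hup : (upPart s).card = (upPart t).card) (hdown : (downPart s).card = (downPart t).card) : A s t = 0 := by
  by_contra hne
  have hoff := mem_iff_mem_of_apply_ne_zero hA hne
  have h0 : orb x 0 ∈ s ↔ orb x 0 ∈ t := by
    have h := mem_iff_mem_of_card_eq (U := upPart s) (V := upPart t) (x := x)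
      (fun y hyx => by rw [mem_upPart, mem_upPart]; exact hoff (orb y 0) hyx) hup
    rwa [mem_upPart, mem_upPart] at h
  have h1 : orb x 1 ∈ s ↔ orb x 1 ∈ t := by
    have h := mem_iff_mem_of_card_eq (U := downPart s) (V := downPart t) (x := x)
      (fun y hyx => by rw [mem_downPart, mem_downPart]; exact hoff (orb y 1) hyx) hdown
    rwa [mem_downPart, mem_downPart] at h
  apply hst
  ext k
  by_cases hk : (ofLex k).1 = x
  · rcases orb_cases k with hk0 | hk1
    · rw [hk0, hk]; exact h0
    · rw [hk1, hk]; exact h1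
  · exact hoff k hk

/-- **Sector compressions of sector-diagonal observables**: if `A` has no entries between distinct configurations of one sector
(e.g. a single-site even observable, `apply_eq_zero_of_mem_carEvenSubalgebra_singleton`, or a scalar), then
`P_{M,N} A P_{M,N} = diag(s ↦ [s ∈ (M,N)] A_{ss})`. -/
theorem spinSectorProj_mul_mul_spinSectorProj_eq_diagonal {A : Matrix (Finset (Orb Λ)) (Finset (Orb Λ)) ℂ}
    (hAd : ∀ s t : Finset (Orb Λ), s ≠ t → (upPart s).card = (upPart t).card → (downPart s).card = (downPart t).card → A s t = 0)
    (M N : ℕ) :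
    spinSectorProj M N * A * spinSectorProj M N =
      diagonal (fun s => if (upPart s).card = M ∧ (downPart s).card = N then A s s else 0) := by
  ext s t
  rw [spinSectorProj, Matrix.mul_assoc, diagonal_mul, mul_diagonal]
  by_cases hst : s = t
  · subst hst
    rw [diagonal_apply_eq]
    by_cases h : (upPart s).card = M ∧ (downPart s).card = N
    · rw [if_pos h, if_pos h, one_mul, mul_one]
    · rw [if_neg h, if_neg h, zero_mul]
  · rw [diagonal_apply_ne _ hst]
    by_cases hs : (upPart s).card = M ∧ (downPart s).card = N
    · by_cases ht : (upPart t).card = M ∧ (downPart t).card = N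
      · rw [hAd s t hst (hs.1.trans ht.1.symm) (hs.2.trans ht.2.symm), zero_mul, mul_zero]
      · rw [if_neg ht, mul_zero, mul_zero]
    · rw [if_neg hs, zero_mul]

end SingleSite

/-! ## §2 Time reversal: `ω_p(A j) = 0` for a single-site even observable off the bond -/

section TimeReversal

variable {ι : Type*} [LinearOrder ι] [Fintype ι]

/-- `dΓ(h)ᵀ = dΓ(hᵀ)` (real Jordan–Wigner matrices: `(c†_i c_j)ᵀ = c†_j c_i`). -/
theorem dGamma_transpose_eq (h : Matrix ι ι ℂ) : (dGamma h)ᵀ = dGamma hᵀ := by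
  rw [dGamma_eq, dGamma_eq, transpose_sum]
  simp only [transpose_sum, transpose_smul, transpose_mul, creation_transpose, annihilation_transpose, transpose_apply]
  rw [Finset.sum_comm]

/-- `(e^{−βH})ᵀ = e^{−βHᵀ}`. -/
theorem gibbsWeight_transpose_eq {m : Type*} [Fintype m] [DecidableEq m] (β : ℝ) (H : Matrix m m ℂ) :
    (gibbsWeight β H)ᵀ = gibbsWeight β Hᵀ := by
  unfold gibbsWeight
  rw [← Matrix.exp_transpose, transpose_smul]

variable {Λ : Type*} [LinearOrder Λ] [Fintype Λ]

/-- The plain bond current `j_{ab} = Σ_σ (−i c†_{aσ}c_{bσ} + i c†_{bσ}c_{aσ})` conserves `(N↑, N↓)`. -/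
theorem preservesSectors_current (a b : Λ) :
    PreservesSectors (∑ σ : Fin 2, ((-Complex.I) • (creation (orb a σ) * annihilation (orb b σ)) +
        Complex.I • (creation (orb b σ) * annihilation (orb a σ))) : Matrix (Finset (Orb Λ)) (Finset (Orb Λ)) ℂ) :=
  PreservesSectors.sum fun σ _ =>
    ((LiebThm1.preservesSectors_hopping a b σ).smul _).add ((LiebThm1.preservesSectors_hopping b a σ).smul _)

/-- **Time reversal (projected-trace form).** For a real-symmetric, sector-preserving `H` and an observable `A` that commutes
with the bond current `j_{ab}` and with the sector projection `P_{M,N}` and has no entries between distinct configurations of one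
sector (a single-site even observable off the bond, or a scalar): `tr(P_{M,N} e^{−βH} A j_{ab}) = 0`. Proof:
`P e^{−βH} A j = e^{−βH} (PAP) j`, `PAP` is diagonal and commutes with `j` (which conserves `(N↑, N↓)`), so `(PAP) j` is an
antisymmetric matrix (tree: `transpose_current`) while `e^{−βH}` is symmetric, and `tr(antisymmetric · symmetric) = 0`. -/
theorem trace_spinSectorProj_mul_gibbsWeight_mul_mul_current_eq_zero {H : Matrix (Finset (Orb Λ)) (Finset (Orb Λ)) ℂ}
    (hH : PreservesSectors H) (hHt : Hᵀ = H) (β : ℝ) (M N : ℕ) (a b : Λ) {A : Matrix (Finset (Orb Λ)) (Finset (Orb Λ)) ℂ}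
    (hAJ : A * (∑ σ : Fin 2, ((-Complex.I) • (creation (orb a σ) * annihilation (orb b σ)) +
          Complex.I • (creation (orb b σ) * annihilation (orb a σ)))) =
      (∑ σ : Fin 2, ((-Complex.I) • (creation (orb a σ) * annihilation (orb b σ)) +
          Complex.I • (creation (orb b σ) * annihilation (orb a σ)))) * A)
    (hAd : ∀ s t : Finset (Orb Λ), s ≠ t → (upPart s).card = (upPart t).card → (downPart s).card = (downPart t).card → A s t = 0)
    (hAP : spinSectorProj M N * A = A * spinSectorProj M N) :
    (spinSectorProj M N * gibbsWeight β H *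
        (A * ∑ σ : Fin 2, ((-Complex.I) • (creation (orb a σ) * annihilation (orb b σ)) +
          Complex.I • (creation (orb b σ) * annihilation (orb a σ))))).trace = 0 := by
  have hPE := spinSectorProj_mul_gibbsWeight_comm hH β M N
  have hPP : spinSectorProj M N * spinSectorProj M N = (spinSectorProj M N : Matrix (Finset (Orb Λ)) (Finset (Orb Λ)) ℂ) :=
    spinSectorProj_mul_self M N
  have hEt : (gibbsWeight β H)ᵀ = gibbsWeight β H := by rw [gibbsWeight_transpose_eq, hHt]
  have hPJ := spinSectorProj_mul_comm_of_preservesSectors (preservesSectors_current a b) M N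
  have hD := spinSectorProj_mul_mul_spinSectorProj_eq_diagonal hAd M N
  have hJt := transpose_current (Λ := Λ) a b
  set P : Matrix (Finset (Orb Λ)) (Finset (Orb Λ)) ℂ := spinSectorProj M N with hPdef
  set E : Matrix (Finset (Orb Λ)) (Finset (Orb Λ)) ℂ := gibbsWeight β H with hEdef
  set J : Matrix (Finset (Orb Λ)) (Finset (Orb Λ)) ℂ :=
    ∑ σ : Fin 2, ((-Complex.I) • (creation (orb a σ) * annihilation (orb b σ)) +
      Complex.I • (creation (orb b σ) * annihilation (orb a σ))) with hJdef
  have hDJ : P * A * P * J = J * (P * A * P) := by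
    calc P * A * P * J = P * A * (P * J) := by rw [Matrix.mul_assoc]
      _ = P * (A * J) * P := by rw [hPJ, ← Matrix.mul_assoc, Matrix.mul_assoc P A J]
      _ = P * J * (A * P) := by rw [hAJ, ← Matrix.mul_assoc, Matrix.mul_assoc]
      _ = J * (P * A * P) := by rw [hPJ, Matrix.mul_assoc, Matrix.mul_assoc]
  have hDt : (P * A * P)ᵀ = P * A * P := by rw [hD, diagonal_transpose]
  have hDJt : (P * A * P * J)ᵀ = -(P * A * P * J) := by
    rw [transpose_mul, hDt, hJt, Matrix.neg_mul, ← hDJ]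
  have hPA : P * A = P * A * P := by
    calc P * A = P * P * A := by rw [hPP]
      _ = P * (P * A) := by rw [Matrix.mul_assoc]
      _ = P * (A * P) := by rw [hAP]
      _ = P * A * P := by rw [← Matrix.mul_assoc]
  have hre : P * E * (A * J) = E * (P * A * P * J) := by
    rw [hPE, Matrix.mul_assoc, ← Matrix.mul_assoc P A J, ← hPA]
  rw [hre, Matrix.trace_mul_comm]
  exact trace_mul_eq_zero_of_transpose hDJt hEt

/-- **Time reversal for the sector Gibbs state.** Under the hypotheses of the previous theorem, with sector preservation stated in the
line's form (`A` has no entries between the sector presented by `p` and its complement): `gibbsState β H_p ((A j_{ab})_p) = 0`. -/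
theorem sectorGibbs_mul_current_eq_zero {H : Matrix (Finset (Orb Λ)) (Finset (Orb Λ)) ℂ}
    (hH : PreservesSectors H) (hHt : Hᵀ = H) (β : ℝ) {M N : ℕ} (p : Finset (Orb Λ) → Prop) [DecidablePred p]
    (hp : ∀ s, p s ↔ (upPart s).card = M ∧ (downPart s).card = N) (a b : Λ) {A : Matrix (Finset (Orb Λ)) (Finset (Orb Λ)) ℂ}
    (hAJ : A * (∑ σ : Fin 2, ((-Complex.I) • (creation (orb a σ) * annihilation (orb b σ)) +
          Complex.I • (creation (orb b σ) * annihilation (orb a σ)))) =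
      (∑ σ : Fin 2, ((-Complex.I) • (creation (orb a σ) * annihilation (orb b σ)) +
          Complex.I • (creation (orb b σ) * annihilation (orb a σ)))) * A)
    (hAd : ∀ s t : Finset (Orb Λ), s ≠ t → (upPart s).card = (upPart t).card → (downPart s).card = (downPart t).card → A s t = 0)
    (hSP : ∀ s t, p s → ¬ p t → A s t = 0 ∧ A t s = 0) :
    gibbsState β (H.toBlock p p)
      ((A * ∑ σ : Fin 2, ((-Complex.I) • (creation (orb a σ) * annihilation (orb b σ)) +
          Complex.I • (creation (orb b σ) * annihilation (orb a σ)))).toBlock p p) = 0 := by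
  have hAP : spinSectorProj M N * A = A * spinSectorProj M N := by
    rw [spinSectorProj_eq_indicator p hp]
    ext s t
    rw [diagonal_mul, mul_diagonal]
    by_cases hs : p s <;> by_cases ht : p t
    · rw [if_pos hs, if_pos ht, one_mul, mul_one]
    · rw [if_pos hs, if_neg ht, (hSP s t hs ht).1, mul_zero, zero_mul]
    · rw [if_neg hs, if_pos ht, (hSP t s ht hs).2, mul_one, zero_mul]
    · rw [if_neg hs, if_neg ht, zero_mul, mul_zero]
  rw [gibbsState_toBlock_eq_sectorTrace hH β p hp,
    trace_spinSectorProj_mul_gibbsWeight_mul_mul_current_eq_zero hH hHt β M N a b hAJ hAd hAP, mul_zero]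

/-- **States are bounded by the operator norm**: for Hermitian sector-preserving `H`, `‖gibbsState β H_p (O_p)‖ ≤ ‖O‖`. -/
theorem norm_sectorGibbs_toBlock_le {H : Matrix (Finset (Orb Λ)) (Finset (Orb Λ)) ℂ} (hHh : H.IsHermitian)
    (hH : PreservesSectors H) (β : ℝ) {M N : ℕ} (p : Finset (Orb Λ) → Prop) [DecidablePred p]
    (hp : ∀ s, p s ↔ (upPart s).card = M ∧ (downPart s).card = N) (O : Matrix (Finset (Orb Λ)) (Finset (Orb Λ)) ℂ) :
    ‖gibbsState β (H.toBlock p p) (O.toBlock p p)‖ ≤ ‖O‖ := by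
  rw [gibbsState_toBlock_eq_sectorTrace hH β p hp O, norm_mul, norm_inv]
  have h1 := norm_trace_spinSectorProj_mul_gibbsWeight_mul_le hHh hH β M N O
  have hre := trace_spinSectorProj_mul_gibbsWeight_eq_re hHh hH β M N
  obtain ⟨hnn, -⟩ := Complex.nonneg_iff.1 (trace_spinSectorProj_mul_gibbsWeight_nonneg hHh hH β M N)
  set Z : ℂ := (spinSectorProj M N * gibbsWeight β H).trace with hZ
  have hZn : ‖Z‖ = Z.re := by
    conv_lhs => rw [hre]
    rw [Complex.norm_real, Real.norm_of_nonneg hnn]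
  by_cases hZ0 : Z = 0
  · rw [hZ0, norm_zero, _root_.inv_zero, zero_mul]; exact norm_nonneg _
  · have hZpos : 0 < ‖Z‖ := norm_pos_iff.2 hZ0
    calc ‖Z‖⁻¹ * ‖(spinSectorProj M N * gibbsWeight β H * O).trace‖ ≤ ‖Z‖⁻¹ * (‖O‖ * Z.re) :=
          mul_le_mul_of_nonneg_left h1 (inv_nonneg.2 (norm_nonneg _))
      _ = ‖O‖ := by rw [← hZn, inv_mul_eq_div, mul_div_assoc, div_self (ne_of_gt hZpos), mul_one]

end TimeReversal

end Summit.Ventures.CertifiedManyBodySolver.Theorems.TcThermcert1.FreeCanonicalB8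

end
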